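import Summits.AtomisticToContinuum.HydrodynamicLimit.Theorems.AntiMazurCoboundariesCorrectorPressureDecayTangentTightnessLaplaceUniquenessCore
import Mathlib.Topology.ContinuousMap.StoneWeierstrass
import Mathlib.MeasureTheory.Measure.HasOuterApproxClosed
import Mathlib.Topology.UrysohnsLemma
import Mathlib.Topology.GDelta.MetrizableSpace
import Mathlib.Topology.Metrizable.Urysohn

/-!
# Tangent tightness, IV: the Laplace functional determines the law of a point process (line `FirstLemma`, crux stmt-AtomisticToContinuum-14135)

Registered stub `stub_laplaceFunctionalDeterminesLaw` of line `FirstLemma` (idea `kifer-compactification`),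
namespace `Summit.AtomisticToContinuum.HydrodynamicLimit.Theorems.KiferCompactification`: the UNFOLDED body of
the named fact `LaplaceFunctionalDeterminesLaw` (Kallenberg, *Foundations of Modern Probability* (2002),
Lemma 12.1) for the tree's locally finite simple configurations `PointConfig X` with their count σ-algebra:
two finite laws `μ, ν` on `PointConfig X` (`X` locally compact, second countable, Hausdorff, Borel) whose Laplace
functionals `E[exp(-∑_{p ∈ ω} f p)]` agree for all continuous compactly supported `f ≥ 0` are equal.

Proof (Kallenberg L12.1 / Daley–Vere-Jones II 9.4.V), on top of `…TangentTightnessLaplaceUniquenessCore.lean`: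
* (a) joint laws of linear statistics: with `f = ∑ₖ nₖ fₖ` the hypothesis gives equality of all mixed moments
  of `Z = (e^{-S_{f₁}}, …, e^{-S_{fₘ}}) ∈ [0,1]^m` (`S_f ω = ∑_{p ∈ ω} f p`; Core file), hence of `∫ p(Z)` for every
  polynomial `p` in the coordinates, hence (STONE–WEIERSTRASS on the cube,
  `ContinuousMap.exists_mem_subalgebra_near_continuous_of_isCompact_of_separatesPoints`) of `∫ g(Z)` for every
  bounded continuous `g`, hence `Z_* μ = Z_* ν` (`ext_of_forall_integral_eq_of_IsFiniteMeasure`): `map_exp_neg_sumFn_eq`;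
* (b) counts of compact sets: `K = g⁻¹{1}` for some `g ∈ C_c(X, [0,1])` (`K` is `Gδ`, `X` being metrizable:
  `exists_continuous_one_zero_of_isCompact_of_isGδ`), and `S_{g^{n+1}}(ω) ↓ N_ω(K)` (Core file), so
  `{N(K₁) < t₁, …, N(Kₘ) < tₘ}` is the increasing union of the events `{S_{g₁^{n+1}} < t₁, …}` of (a):
  `measure_compactCountEvent_eq`;
* (c) these compact count events form a π-system generating the count σ-algebra (Core file:
  `isPiSystem_compactCountEvents`, `generateFrom_compactCountEvents`) and `μ univ = ν univ` (`f = 0`), so `μ = ν`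
  by `MeasureTheory.ext_of_generate_finite`.

References: O. Kallenberg, *Foundations of Modern Probability*, 2nd ed. (2002), Lemma 12.1, Thm. A2.3;
D. J. Daley, D. Vere-Jones, *An Introduction to the Theory of Point Processes* II (2008), Thm. 9.4.V.
-/

noncomputable section

open MeasureTheory Set Filter Topology Function
open scoped ENNReal NNReal BoundedContinuousFunction

namespace Summit.AtomisticToContinuum.HydrodynamicLimit.Theorems.KiferCompactification

open Literature.Analysis.FunctionSpaces (PointConfig)
open Literature.MathematicalPhysics.KineticTheory.PointProcess (laplaceFunctional measurable_exp_neg_finsum)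

variable {X : Type*} [TopologicalSpace X]

/-! ## Joint laws of linear statistics (Stone–Weierstrass) -/

section Laplace

variable [T2Space X] [LocallyCompactSpace X] [SecondCountableTopology X] [MeasurableSpace X] [BorelSpace X]
  {μ ν : Measure (PointConfig X)} [IsFiniteMeasure μ] [IsFiniteMeasure ν]

/-- The vector `(e^{-S_{f_k}(ω)})_k` of a finite family of continuous compactly supported `f_k ≥ 0` is a
measurable map into `κ → ℝ`. -/
theorem measurable_exp_neg_sumFn_pi {κ : Type*} [Fintype κ] {f : κ → X → ℝ} (hf : ∀ k, Continuous (f k))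
    (hcs : ∀ k, HasCompactSupport (f k)) (h0 : ∀ k x, 0 ≤ f k x) :
    Measurable fun (ω : PointConfig X) (k : κ) => Real.exp (-(ω.sumFn (f k))) :=
  measurable_pi_lambda _ fun k => measurable_exp_neg_finsum (hf k).measurable (hcs k) (h0 k)

/-- The monomials `x ↦ ∏ₖ (x k)^{nₖ}` exhaust the submonoid of `C(κ → ℝ, ℝ)` generated by the coordinates. -/
private theorem exists_eq_prod_pow_of_mem_closure {κ : Type*} [Fintype κ] {q : C(κ → ℝ, ℝ)}
    (hq : q ∈ Submonoid.closure
      (Set.range fun k : κ => (⟨fun x => x k, continuous_apply k⟩ : C(κ → ℝ, ℝ)))) :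
    ∃ n : κ → ℕ, ∀ x, q x = ∏ k, x k ^ n k := by
  classical
  induction hq using Submonoid.closure_induction with
  | mem q hq =>
    obtain ⟨k, rfl⟩ := hq
    refine ⟨Pi.single k 1, fun x => ?_⟩
    rw [Finset.prod_eq_single k (fun j _ hj => by rw [Pi.single_eq_of_ne hj, pow_zero])
      (fun h => absurd (Finset.mem_univ k) h)]
    simp
  | one => exact ⟨0, fun x => by simp⟩
  | mul q q' _ _ ih ih' =>
    obtain ⟨n, hn⟩ := ih
    obtain ⟨n', hn'⟩ := ih'
    refine ⟨n + n', fun x => ?_⟩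
    rw [ContinuousMap.mul_apply, hn, hn', ← Finset.prod_mul_distrib]
    refine Finset.prod_congr rfl fun k _ => ?_
    rw [Pi.add_apply, pow_add]

/-- Under the Laplace hypothesis, `∫ p(e^{-S_{f₁}}, …, e^{-S_{fₘ}})` agree under `μ` and `ν` for every polynomial
`p` in the coordinates (linear span of the monomials). -/
private theorem integral_comp_eq_of_mem_adjoin {κ : Type*} [Fintype κ]
    (hL : ∀ f : X → ℝ, Continuous f → HasCompactSupport f → (∀ x, 0 ≤ f x) →
      laplaceFunctional μ f = laplaceFunctional ν f)
    {f : κ → X → ℝ} (hf : ∀ k, Continuous (f k)) (hcs : ∀ k, HasCompactSupport (f k))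
    (h0 : ∀ k x, 0 ≤ f k x) {p : C(κ → ℝ, ℝ)}
    (hp : p ∈ Algebra.adjoin ℝ
      (Set.range fun k : κ => (⟨fun x => x k, continuous_apply k⟩ : C(κ → ℝ, ℝ)))) :
    Integrable (fun ω : PointConfig X => p fun k => Real.exp (-(ω.sumFn (f k)))) μ ∧
      Integrable (fun ω : PointConfig X => p fun k => Real.exp (-(ω.sumFn (f k)))) ν ∧
        ∫ ω, p (fun k => Real.exp (-(ω.sumFn (f k)))) ∂μ =
          ∫ ω, p (fun k => Real.exp (-(ω.sumFn (f k)))) ∂ν := by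
  have hZ := measurable_exp_neg_sumFn_pi hf hcs h0
  have hp' : p ∈ Submodule.span ℝ ((Submonoid.closure (Set.range fun k : κ =>
      (⟨fun x => x k, continuous_apply k⟩ : C(κ → ℝ, ℝ))) : Set C(κ → ℝ, ℝ))) := by
    rw [← Algebra.adjoin_eq_span]
    exact hp
  clear hp
  induction hp' using Submodule.span_induction with
  | mem q hq =>
    obtain ⟨n, hn⟩ := exists_eq_prod_pow_of_mem_closure hq
    have hqZ : ∀ ω : PointConfig X, q (fun k => Real.exp (-(ω.sumFn (f k)))) =
        ∏ k, Real.exp (-(ω.sumFn (f k))) ^ n k := fun ω => hn _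
    have hmeas : ∀ ρ : Measure (PointConfig X),
        AEStronglyMeasurable (fun ω : PointConfig X => q fun k => Real.exp (-(ω.sumFn (f k)))) ρ :=
      fun ρ => (q.continuous.measurable.comp hZ).aestronglyMeasurable
    have hbd : ∀ ω : PointConfig X, ‖q fun k => Real.exp (-(ω.sumFn (f k)))‖ ≤ 1 := by
      intro ω
      rw [hqZ, Real.norm_eq_abs,
        abs_of_nonneg (Finset.prod_nonneg fun k _ => pow_nonneg (Real.exp_nonneg _) _)]
      exact Finset.prod_le_one (fun k _ => pow_nonneg (Real.exp_nonneg _) _) fun k _ =>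
        pow_le_one₀ (Real.exp_nonneg _)
          (Real.exp_le_one_iff.2 (neg_nonpos.2 (PointConfig.sumFn_nonneg _ (h0 k))))
    refine ⟨Integrable.of_bound (hmeas μ) 1 (ae_of_all _ hbd),
      Integrable.of_bound (hmeas ν) 1 (ae_of_all _ hbd), ?_⟩
    simp_rw [hqZ]
    exact integral_prod_pow_exp_neg_sumFn_eq hL hf hcs h0 n
  | zero => simp
  | add q q' _ _ ih ih' =>
    obtain ⟨h1, h2, h3⟩ := ih
    obtain ⟨h1', h2', h3'⟩ := ih'
    simp only [ContinuousMap.add_apply]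
    exact ⟨h1.add h1', h2.add h2', by rw [integral_add h1 h1', integral_add h2 h2', h3, h3']⟩
  | smul a q _ ih =>
    obtain ⟨h1, h2, h3⟩ := ih
    simp only [ContinuousMap.smul_apply, smul_eq_mul]
    exact ⟨h1.const_mul a, h2.const_mul a, by rw [integral_const_mul, integral_const_mul, h3]⟩

/-- **Stone–Weierstrass step.** Under the Laplace hypothesis, `∫ g(e^{-S_{f₁}}, …, e^{-S_{fₘ}})` agree under `μ`
and `ν` for every bounded continuous `g` on `κ → ℝ`: polynomials in the coordinates separate points, hence
approximate `g` uniformly on the cube `[0,1]^κ` where the vector takes its values. -/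
theorem integral_comp_exp_neg_sumFn_eq {κ : Type*} [Fintype κ]
    (hL : ∀ f : X → ℝ, Continuous f → HasCompactSupport f → (∀ x, 0 ≤ f x) →
      laplaceFunctional μ f = laplaceFunctional ν f)
    {f : κ → X → ℝ} (hf : ∀ k, Continuous (f k)) (hcs : ∀ k, HasCompactSupport (f k))
    (h0 : ∀ k x, 0 ≤ f k x) (g : (κ → ℝ) →ᵇ ℝ) :
    ∫ ω, g (fun k => Real.exp (-(ω.sumFn (f k)))) ∂μ =
      ∫ ω, g (fun k => Real.exp (-(ω.sumFn (f k)))) ∂ν := by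
  set A : Subalgebra ℝ C(κ → ℝ, ℝ) := Algebra.adjoin ℝ
    (Set.range fun k : κ => (⟨fun x => x k, continuous_apply k⟩ : C(κ → ℝ, ℝ))) with hA_def
  have hA : A.SeparatesPoints := by
    intro x y hxy
    obtain ⟨k, hk⟩ := Function.ne_iff.1 hxy
    exact ⟨_, ⟨_, Algebra.subset_adjoin ⟨k, rfl⟩, rfl⟩, hk⟩
  have hZ := measurable_exp_neg_sumFn_pi hf hcs h0
  have hZmem : ∀ ω : PointConfig X,
      (fun k => Real.exp (-(ω.sumFn (f k)))) ∈ Set.pi univ fun _ : κ => Icc (0 : ℝ) 1 :=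
    fun ω => mem_univ_pi.2 fun k =>
      ⟨Real.exp_nonneg _, Real.exp_le_one_iff.2 (neg_nonpos.2 (ω.sumFn_nonneg (h0 k)))⟩
  have hgi : ∀ (ρ : Measure (PointConfig X)) [IsFiniteMeasure ρ],
      Integrable (fun ω : PointConfig X => g fun k => Real.exp (-(ω.sumFn (f k)))) ρ :=
    fun ρ _ => Integrable.of_bound (g.continuous.measurable.comp hZ).aestronglyMeasurable ‖g‖
      (ae_of_all _ fun ω => g.norm_coe_le_norm _)
  refine eq_of_forall_dist_le fun ε hε => ?_
  have hM : 0 < μ.real univ + ν.real univ + 1 := by positivity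
  obtain ⟨p, hpA, hp⟩ := ContinuousMap.exists_mem_subalgebra_near_continuous_of_isCompact_of_separatesPoints hA
    g.toContinuousMap (isCompact_univ_pi fun _ : κ => isCompact_Icc) (div_pos hε hM)
  obtain ⟨hpμ, hpν, hpeq⟩ := integral_comp_eq_of_mem_adjoin hL hf hcs h0 hpA
  have key : ∀ (ρ : Measure (PointConfig X)) [IsFiniteMeasure ρ],
      Integrable (fun ω : PointConfig X => p fun k => Real.exp (-(ω.sumFn (f k)))) ρ →
        ‖∫ ω, g (fun k => Real.exp (-(ω.sumFn (f k)))) ∂ρ -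
            ∫ ω, p (fun k => Real.exp (-(ω.sumFn (f k)))) ∂ρ‖ ≤
          ε / (μ.real univ + ν.real univ + 1) * ρ.real univ := by
    intro ρ _ hpρ
    rw [← integral_sub (hgi ρ) hpρ]
    refine norm_integral_le_of_norm_le_const (ae_of_all _ fun ω => ?_)
    rw [norm_sub_rev]
    exact (hp _ (hZmem ω)).le
  have h1 := key μ hpμ
  have h2 := key ν hpν
  rw [dist_eq_norm]
  calc ‖∫ ω, g (fun k => Real.exp (-(ω.sumFn (f k)))) ∂μ -
        ∫ ω, g (fun k => Real.exp (-(ω.sumFn (f k)))) ∂ν‖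
      = ‖(∫ ω, g (fun k => Real.exp (-(ω.sumFn (f k)))) ∂μ -
            ∫ ω, p (fun k => Real.exp (-(ω.sumFn (f k)))) ∂μ) -
          (∫ ω, g (fun k => Real.exp (-(ω.sumFn (f k)))) ∂ν -
            ∫ ω, p (fun k => Real.exp (-(ω.sumFn (f k)))) ∂ν)‖ := by
        rw [hpeq, sub_sub_sub_cancel_right]
    _ ≤ ε / (μ.real univ + ν.real univ + 1) * μ.real univ +
          ε / (μ.real univ + ν.real univ + 1) * ν.real univ := (norm_sub_le _ _).trans (add_le_add h1 h2)
    _ ≤ ε := by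
        rw [← mul_add, div_mul_eq_mul_div, div_le_iff₀ hM]
        nlinarith [measureReal_nonneg (μ := μ) (s := univ), measureReal_nonneg (μ := ν) (s := univ)]

/-- **Joint laws of finitely many linear statistics agree** (Kallenberg L12.1, first step): under the Laplace
hypothesis, the laws of `(e^{-S_{f₁}}, …, e^{-S_{fₘ}})` under `μ` and `ν` coincide as Borel measures on `κ → ℝ`. -/
theorem map_exp_neg_sumFn_eq {κ : Type*} [Fintype κ]
    (hL : ∀ f : X → ℝ, Continuous f → HasCompactSupport f → (∀ x, 0 ≤ f x) →
      laplaceFunctional μ f = laplaceFunctional ν f)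
    {f : κ → X → ℝ} (hf : ∀ k, Continuous (f k)) (hcs : ∀ k, HasCompactSupport (f k))
    (h0 : ∀ k x, 0 ≤ f k x) :
    μ.map (fun (ω : PointConfig X) (k : κ) => Real.exp (-(ω.sumFn (f k)))) =
      ν.map (fun (ω : PointConfig X) (k : κ) => Real.exp (-(ω.sumFn (f k)))) := by
  have hZ := measurable_exp_neg_sumFn_pi hf hcs h0
  refine ext_of_forall_integral_eq_of_IsFiniteMeasure fun g => ?_
  rw [integral_map hZ.aemeasurable g.continuous.aestronglyMeasurable,
    integral_map hZ.aemeasurable g.continuous.aestronglyMeasurable]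
  exact integral_comp_exp_neg_sumFn_eq hL hf hcs h0 g

/-- Under the Laplace hypothesis the events `{S_{f₁} < t₁, …, S_{fₘ} < tₘ}` have the same mass. -/
theorem measure_setOf_forall_sumFn_lt_eq {κ : Type*} [Fintype κ]
    (hL : ∀ f : X → ℝ, Continuous f → HasCompactSupport f → (∀ x, 0 ≤ f x) →
      laplaceFunctional μ f = laplaceFunctional ν f)
    {f : κ → X → ℝ} (hf : ∀ k, Continuous (f k)) (hcs : ∀ k, HasCompactSupport (f k))
    (h0 : ∀ k x, 0 ≤ f k x) (t : κ → ℝ) :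
    μ {ω | ∀ k, ω.sumFn (f k) < t k} = ν {ω | ∀ k, ω.sumFn (f k) < t k} := by
  have hZ := measurable_exp_neg_sumFn_pi hf hcs h0
  have hB : MeasurableSet {x : κ → ℝ | ∀ k, Real.exp (-t k) < x k} := by
    rw [Set.setOf_forall]
    exact MeasurableSet.iInter fun k => measurableSet_lt measurable_const (measurable_pi_apply k)
  have hset : {ω : PointConfig X | ∀ k, ω.sumFn (f k) < t k} =
      (fun (ω : PointConfig X) (k : κ) => Real.exp (-(ω.sumFn (f k)))) ⁻¹'
        {x | ∀ k, Real.exp (-t k) < x k} := by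
    ext ω
    simp only [mem_setOf_eq, mem_preimage, Real.exp_lt_exp, neg_lt_neg_iff]
  rw [hset, ← Measure.map_apply hZ hB, ← Measure.map_apply hZ hB, map_exp_neg_sumFn_eq hL hf hcs h0]

/-! ## Counts of compact sets from linear statistics -/

/-- **Counts of compact sets have the same joint laws** (Kallenberg L12.1, second step): under the Laplace
hypothesis, `μ {N(K₁) < t₁, …, N(Kₘ) < tₘ} = ν {…}` for compact `Kₖ` — the event is the increasing union
of the events `{S_{g₁^{n+1}} < t₁, …, S_{gₘ^{n+1}} < tₘ}` (`gₖ ∈ C_c(X, [0,1])` with `Kₖ = gₖ⁻¹{1}`, which exist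
since compact sets are `Gδ` in the metrizable space `X`), whose masses agree by `measure_setOf_forall_sumFn_lt_eq`. -/
theorem measure_compactCountEvent_eq {κ : Type*} [Fintype κ]
    (hL : ∀ f : X → ℝ, Continuous f → HasCompactSupport f → (∀ x, 0 ≤ f x) →
      laplaceFunctional μ f = laplaceFunctional ν f)
    {K : κ → Set X} (hK : ∀ k, IsCompact (K k)) (t : κ → ℕ) :
    μ {ω | ∀ k, ω.count (K k) < (t k : ℕ∞)} = ν {ω | ∀ k, ω.count (K k) < (t k : ℕ∞)} := by
  -- Urysohn functions with `K k = g k ⁻¹' {1}`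
  have hg : ∀ k, ∃ g : C(X, ℝ), K k = g ⁻¹' {1} ∧ HasCompactSupport g ∧ ∀ x, g x ∈ Icc (0 : ℝ) 1 := by
    intro k
    obtain ⟨g, h1, -, h2, h3⟩ := exists_continuous_one_zero_of_isCompact_of_isGδ (hK k)
      (hK k).isClosed.isGδ isClosed_empty (disjoint_empty _)
    exact ⟨g, h1, h2, h3⟩
  choose g hgK hgc hg01 using hg
  -- the approximating events
  set A : ℕ → Set (PointConfig X) :=
    fun n => {ω | ∀ k, (ω.sumFn fun x => g k x ^ (n + 1)) < t k} with hA
  have hAeq : ∀ n, μ (A n) = ν (A n) := fun n =>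
    measure_setOf_forall_sumFn_lt_eq hL (f := fun k x => g k x ^ (n + 1))
      (fun k => (g k).continuous.pow _)
      (fun k => (hgc k).comp_left (g := fun y : ℝ => y ^ (n + 1)) (by simp))
      (fun k x => pow_nonneg (hg01 k x).1 _) fun k => (t k : ℝ)
  have hfacts := fun (ω : PointConfig X) (k : κ) =>
    sumFn_pow_succ_facts ω (hgK k) (hgc k) (hg01 k) (t k)
  have hmono : Monotone A := by
    intro m n hmn ω hω
    simp only [hA, mem_setOf_eq] at hω ⊢
    exact fun k => lt_of_le_of_lt ((hfacts ω k).1 hmn) (hω k)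
  have hU : (⋃ n, A n) = {ω | ∀ k, ω.count (K k) < (t k : ℕ∞)} := by
    ext ω
    simp only [mem_iUnion, hA, mem_setOf_eq]
    constructor
    · rintro ⟨n, hn⟩ k
      exact (hfacts ω k).2.1 n (hn k)
    · intro hω
      exact (eventually_all.2 fun k => (hfacts ω k).2.2 (hω k)).exists
  rw [← hU, hmono.measure_iUnion, hmono.measure_iUnion]
  exact iSup_congr hAeq

end Laplace

/-! ## The registered stub -/

/-- **THE LAPLACE FUNCTIONAL DETERMINES THE LAW OF A POINT PROCESS** (Kallenberg, *Foundations of Modern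
Probability* (2002), Lemma 12.1, on the tree's `PointConfig X` with its count σ-algebra; registered stub
`stub_laplaceFunctionalDeterminesLaw` of line `FirstLemma`, crux stmt-AtomisticToContinuum-14135 — the unfolded
body of the named fact `LaplaceFunctionalDeterminesLaw`). Two finite laws on the locally finite simple
configurations of a locally compact, second countable Hausdorff space whose Laplace functionals agree on all
continuous compactly supported `f ≥ 0` are equal: they have the same mass (`f = 0`) and agree on the compact count
events (`measure_compactCountEvent_eq`), a π-system generating the count σ-algebra
(`generateFrom_compactCountEvents`). -/
theorem stub_laplaceFunctionalDeterminesLaw :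
    ∀ (X : Type) [TopologicalSpace X] [T2Space X] [LocallyCompactSpace X] [SecondCountableTopology X]
      [MeasurableSpace X] [BorelSpace X]
      {μ ν : MeasureTheory.Measure (Literature.Analysis.FunctionSpaces.PointConfig X)}
      [MeasureTheory.IsFiniteMeasure μ] [MeasureTheory.IsFiniteMeasure ν],
      (∀ f : X → ℝ, Continuous f → HasCompactSupport f → (∀ x, 0 ≤ f x) →
        Literature.MathematicalPhysics.KineticTheory.PointProcess.laplaceFunctional μ f =
          Literature.MathematicalPhysics.KineticTheory.PointProcess.laplaceFunctional ν f) → μ = ν := by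
  intro X _ _ _ _ _ _ μ ν _ _ hL
  have huniv : μ univ = ν univ := by
    have h := hL 0 continuous_zero HasCompactSupport.zero fun _ => le_rfl
    rw [laplaceFunctional_zero, laplaceFunctional_zero, measureReal_def, measureReal_def] at h
    exact (ENNReal.toReal_eq_toReal_iff' (measure_ne_top μ _) (measure_ne_top ν _)).1 h
  refine ext_of_generate_finite _ generateFrom_compactCountEvents.symm isPiSystem_compactCountEvents
    (fun A hA => ?_) huniv
  obtain ⟨κ, hκ, K, t, hK, rfl⟩ := hA
  exact measure_compactCountEvent_eq hL hK t

end Summit.AtomisticToContinuum.HydrodynamicLimit.Theorems.KiferCompactification
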